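import Mathlib
import Literature.Analysis.FluidPDE.VectorCalculus
import Literature.Analysis.FluidPDE.RadialCalculus
import Summits.NavierStokesRegularity.NavierStokesRegularity.Theorems.UnthreadedDoorKinematicShadowPointSourceCalculus
import HarnessLib

/-!
# Crux `PoloidalLiouville` (stmt-NavierStokesRegularity-1222, W1), crux idea «kinematic-shadow» (ns-idea-15 g6):
# A POINT SOURCE MAINTAINS A BOUNDED TOROIDAL DIPOLE — the steady kinematic shadow is false on the punctured space

Support file (`--supports stmt-NavierStokesRegularity-1222`, helper), sequel of
`UnthreadedDoorKinematicShadowPointSourceCalculus`.  Experiment cell `ns-wall-extremal`, width hand ns-wall-eng-5 g6.  0 kit.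

THE WITNESS.  Centre `x₀ = 0`, axis `e ∈ ℝ³`.  Drift = the unit POINT SOURCE `u(x) = x/‖x‖³` (smooth, divergence free and
irrotational on `ℝ³ ∖ {0}`, `‖u(x)‖ = ‖x‖⁻²`; `div u = 4π δ₀` as a distribution).  Potential `T(x) = ⟪e, x⟫ Φ(‖x‖)` with the
profile
  `Φ(r) = 2 − e^{−1/r} (r⁻² + 2 r⁻¹ + 2) = ∫₀^{1/r} s² e^{−s} ds`,
the bounded solution of `Φ″ + (4/r − 1/r²) Φ′ = 0` (`Φ′(r) = −e^{−1/r}/r⁴`; `Φ(0⁺) = 2`, `Φ(r) ∼ 1/(3r³)` at infinity) — the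
`c₀ = 1`, bounded member of the `l = 1` point-source family of the card `Ideas/kinematic-shadow.md` §B.  The toroidal field is the
DIPOLE `B = ∇T × x = Φ(‖x‖) · (e × x)`, smooth, `‖B‖ ≤ 2‖e‖`, vanishing at the centre and at infinity.

* `KinematicShadow.PointSource.hasDerivAt_profile`, `profile_nonneg`, `profile_le`, `profile_one_pos` — calculus of `Φ`;
* `KinematicShadow.pointSourceDipole` — the packaged witness: regularity of `u`, `T` off `0`, `div u = 0` and `‖u‖ = ‖x‖⁻²`
  off `0`, the bounds `|T| ≤ 2‖e‖`, `‖∇T × x‖ ≤ 2‖e‖` on all of `ℝ³`, the STEADY KINEMATIC LAW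
  `∇(⟪u,∇T⟫ − ΔT) × (x − 0) = ∇⟪u, · − 0⟫ × ∇T` on `{0}ᶜ` — the body of the sketch's `SteadyKinematicLawOn u T 0 {0}ᶜ`
  (`Cruxes/PoloidalLiouville/KinematicShadowSketch.lean` l.57) — and `∇T × x ≠ 0` at `x = e₁` for `e = e₃`;
* `KinematicShadow.kinematicShadowSteady_false_without_centre` — **the sketch's `KinematicShadowSteady` (l.140) with its three
  drift binders `ContDiff ℝ 1 u → IsDivFree u → (∀ x, ‖u x‖ ≤ K)` weakened to the punctured space
  `ContDiffOn ℝ 1 u {x₀}ᶜ → (∀ x ≠ x₀, div u x = 0) → (∀ x ≠ x₀, ‖u x‖ ≤ K/‖x − x₀‖²)` (potential binders and conclusion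
  unchanged) is FALSE.**

READING (information-grade; the card's REMARK (d) «the whole-space shadow is decided AT THE CENTRE» made quantitative): what
any proof of the steady kinematic shadow must consume is the drift's regularity / solenoidality AT the centre — not boundedness
or decay of `T`, `B` (both hold here), not smoothness off the centre, not decay of `u` at infinity (here `u → 0`).  A source of
fluid at the centre sweeps the dipole outward exactly as fast as it diffuses inward.

HONEST FRAME: an explicit solution of a LINEAR kinematic system (the induction equation for a toroidal field under a prescribed
drift); the typed shadow `KinematicShadowSteady` / `KinematicShadowAncient`, the wall `stub_scalarLiouville`, the crux
`PoloidalLiouville` (1222) and NS regularity are untouched and OPEN.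

## References
* H. K. Moffatt, *Magnetic Field Generation in Electrically Conducting Fluids* (CUP 1978), §2.1–2.3. [Moffatt1978]
* R. Kaiser, The non-existence of toroidal … (toroidal field theorem), Commun. Math. Phys. 290 (2009) 633. [Kaiser2009]
-/

-- the summit and its single problem share the name (D-0017 nested layout)
set_option linter.dupNamespace false

noncomputable section

namespace Summit.NavierStokesRegularity.NavierStokesRegularity.Theorems.PoloidalLiouville.KinematicShadow

open Set Function Filter Topology Metric
open scoped Topology RealInnerProductSpace Laplacian ContDiff
open Literature.Analysis.FluidPDE
open Summit.NavierStokesRegularity.NavierStokesRegularity.Theorems.PoloidalLiouville.HorizonTower (E3)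

namespace PointSource

/-! ### The profile `Φ(r) = 2 − e^{−1/r}(r⁻² + 2r⁻¹ + 2)` -/

/-- `Φ′(r) = −e^{−1/r} r⁻⁴` (`r ≠ 0`). -/
theorem hasDerivAt_profile {t : ℝ} (ht : t ≠ 0) :
    HasDerivAt (fun r : ℝ => 2 - Real.exp (-r⁻¹) * (r⁻¹ ^ 2 + 2 * r⁻¹ + 2))
      (-(Real.exp (-t⁻¹) * (t ^ 4)⁻¹)) t := by
  have hi : HasDerivAt (fun r : ℝ => r⁻¹) (-(t ^ 2)⁻¹) t := hasDerivAt_inv ht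
  have hE : HasDerivAt (fun r : ℝ => Real.exp (-r⁻¹)) (Real.exp (-t⁻¹) * (-(-(t ^ 2)⁻¹))) t := hi.neg.exp
  have hq : HasDerivAt (fun r : ℝ => r⁻¹ ^ 2 + 2 * r⁻¹ + 2)
      (2 * t⁻¹ ^ 1 * (-(t ^ 2)⁻¹) + 2 * (-(t ^ 2)⁻¹) + 0) t :=
    ((hi.pow 2).add (hi.const_mul 2)).add (hasDerivAt_const t 2)
  have h := (hasDerivAt_const t (2 : ℝ)).sub (hE.mul hq)
  refine h.congr_deriv ?_
  field_simp
  ring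

/-- `Φ₁(r) := −e^{−1/r}/(2r⁵)` has `Φ₁′(r) = e^{−1/r}(5r − 1)/(2r⁷)` (`r ≠ 0`). -/
theorem hasDerivAt_profile₁ {t : ℝ} (ht : t ≠ 0) :
    HasDerivAt (fun r : ℝ => -(Real.exp (-r⁻¹) / (2 * r ^ 5)))
      (Real.exp (-t⁻¹) * (5 * t - 1) / (2 * t ^ 7)) t := by
  have hi : HasDerivAt (fun r : ℝ => r⁻¹) (-(t ^ 2)⁻¹) t := hasDerivAt_inv ht
  have hE : HasDerivAt (fun r : ℝ => Real.exp (-r⁻¹)) (Real.exp (-t⁻¹) * (-(-(t ^ 2)⁻¹))) t := hi.neg.exp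
  have hd : HasDerivAt (fun r : ℝ => 2 * r ^ 5) (2 * (5 * t ^ 4 * 1)) t := ((hasDerivAt_id t).pow 5).const_mul 2
  have hne : 2 * t ^ 5 ≠ 0 := by positivity
  have h := (hE.div hd hne).neg
  refine h.congr_deriv ?_
  field_simp
  ring

/-- `0 ≤ Φ(r)` for `r > 0` (`1 + s + s²/2 ≤ eˢ` at `s = 1/r`). -/
theorem profile_nonneg {t : ℝ} (ht : 0 < t) : 0 ≤ 2 - Real.exp (-t⁻¹) * (t⁻¹ ^ 2 + 2 * t⁻¹ + 2) := by
  set s : ℝ := t⁻¹ with hs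
  have hs0 : 0 ≤ s := by positivity
  have hexp : 1 + s + s ^ 2 / 2 ≤ Real.exp s := Real.quadratic_le_exp_of_nonneg hs0
  have hpos : 0 < Real.exp s := Real.exp_pos s
  rw [Real.exp_neg]
  rw [sub_nonneg, inv_mul_le_iff₀ hpos]
  nlinarith

/-- `Φ(r) ≤ 2/r` for `r > 0` (`1 − s ≤ e^{−s}` at `s = 1/r`, and trivially for `s ≥ 1`). -/
theorem profile_le {t : ℝ} (ht : 0 < t) : 2 - Real.exp (-t⁻¹) * (t⁻¹ ^ 2 + 2 * t⁻¹ + 2) ≤ 2 * t⁻¹ := by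
  set s : ℝ := t⁻¹ with hs
  have hs0 : 0 ≤ s := by positivity
  have hE0 : 0 < Real.exp (-s) := Real.exp_pos _
  have hq0 : 0 ≤ s ^ 2 + 2 * s + 2 := by positivity
  by_cases h1 : 1 ≤ s
  · nlinarith [mul_nonneg hE0.le hq0]
  · have h1 : s < 1 := lt_of_not_ge h1
    have hexp : 1 - s ≤ Real.exp (-s) := by linarith [Real.add_one_le_exp (-s)]
    have hmul : (1 - s) * (s ^ 2 + 2 * s + 2) ≤ Real.exp (-s) * (s ^ 2 + 2 * s + 2) :=
      mul_le_mul_of_nonneg_right hexp hq0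
    nlinarith

/-- `r · Φ(r) ≤ 2` for `r > 0`. -/
theorem mul_profile_le {t : ℝ} (ht : 0 < t) : t * (2 - Real.exp (-t⁻¹) * (t⁻¹ ^ 2 + 2 * t⁻¹ + 2)) ≤ 2 := by
  have h := mul_le_mul_of_nonneg_left (profile_le ht) ht.le
  have h2 : t * (2 * t⁻¹) = 2 := by field_simp
  linarith

/-- `Φ(1) = 2 − 5/e > 0`. -/
theorem profile_one_pos : 0 < 2 - Real.exp (-(1 : ℝ)⁻¹) * ((1 : ℝ)⁻¹ ^ 2 + 2 * (1 : ℝ)⁻¹ + 2) := by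
  have he : (2.7182818283 : ℝ) < Real.exp 1 := Real.exp_one_gt_d9
  have hpos : 0 < Real.exp 1 := Real.exp_pos 1
  rw [inv_one, Real.exp_neg]
  have h5 : (Real.exp 1)⁻¹ * ((1 : ℝ) ^ 2 + 2 * 1 + 2) = 5 / Real.exp 1 := by ring
  rw [h5, sub_pos, div_lt_iff₀ hpos]
  linarith

/-- `Φ` is smooth off `0`. -/
theorem contDiffAt_profile {t : ℝ} (ht : t ≠ 0) {n : WithTop ℕ∞} :
    ContDiffAt ℝ n (fun r : ℝ => 2 - Real.exp (-r⁻¹) * (r⁻¹ ^ 2 + 2 * r⁻¹ + 2)) t := by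
  have hi : ContDiffAt ℝ n (fun r : ℝ => r⁻¹) t := contDiffAt_inv ℝ ht
  exact contDiffAt_const.sub ((hi.neg.exp).mul (((hi.pow 2).add (contDiffAt_const.mul hi)).add contDiffAt_const))

/-! ### The profile in the variable `σ = r²` and the radial ODE -/

/-- `P(σ) := Φ(√σ)` is differentiable at `σ > 0` with `P′(σ) = −e^{−1/√σ}/(2(√σ)⁵)`. -/
theorem hasDerivAt_P {σ : ℝ} (hσ : 0 < σ) :
    HasDerivAt (fun s : ℝ => 2 - Real.exp (-(Real.sqrt s)⁻¹) * ((Real.sqrt s)⁻¹ ^ 2 + 2 * (Real.sqrt s)⁻¹ + 2))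
      (-(Real.exp (-(Real.sqrt σ)⁻¹) / (2 * Real.sqrt σ ^ 5))) σ := by
  have ht : Real.sqrt σ ≠ 0 := (Real.sqrt_pos.2 hσ).ne'
  have h := (hasDerivAt_profile ht).comp σ (Real.hasDerivAt_sqrt hσ.ne')
  refine h.congr_deriv ?_
  field_simp

/-- `P′(σ) = −e^{−1/√σ}/(2(√σ)⁵)` is differentiable at `σ > 0` with `P″(σ) = e^{−1/√σ}(5√σ − 1)/(4(√σ)⁸)`. -/
theorem hasDerivAt_P₁ {σ : ℝ} (hσ : 0 < σ) :
    HasDerivAt (fun s : ℝ => -(Real.exp (-(Real.sqrt s)⁻¹) / (2 * Real.sqrt s ^ 5)))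
      (Real.exp (-(Real.sqrt σ)⁻¹) * (5 * Real.sqrt σ - 1) / (4 * Real.sqrt σ ^ 8)) σ := by
  have ht : Real.sqrt σ ≠ 0 := (Real.sqrt_pos.2 hσ).ne'
  have h := (hasDerivAt_profile₁ ht).comp σ (Real.hasDerivAt_sqrt hσ.ne')
  refine h.congr_deriv ?_
  field_simp
  ring

/-- `P` is `C²` (indeed smooth) at `σ > 0`. -/
theorem contDiffAt_P {σ : ℝ} (hσ : 0 < σ) {n : WithTop ℕ∞} :
    ContDiffAt ℝ n
      (fun s : ℝ => 2 - Real.exp (-(Real.sqrt s)⁻¹) * ((Real.sqrt s)⁻¹ ^ 2 + 2 * (Real.sqrt s)⁻¹ + 2)) σ := by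
  have ht : Real.sqrt σ ≠ 0 := (Real.sqrt_pos.2 hσ).ne'
  exact (contDiffAt_profile ht).comp σ (Real.contDiffAt_sqrt hσ.ne')

/-- **The radial ODE** `4σP″ + 10P′ = 2σ^{−1/2}P′` on `σ > 0` (i.e. `Φ″ + (4/r − 1/r²)Φ′ = 0`). -/
theorem radialODE {σ : ℝ} (hσ : 0 < σ) :
    4 * σ * (Real.exp (-(Real.sqrt σ)⁻¹) * (5 * Real.sqrt σ - 1) / (4 * Real.sqrt σ ^ 8))
        + 10 * (-(Real.exp (-(Real.sqrt σ)⁻¹) / (2 * Real.sqrt σ ^ 5)))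
      = 2 * (Real.sqrt σ)⁻¹ * (-(Real.exp (-(Real.sqrt σ)⁻¹) / (2 * Real.sqrt σ ^ 5))) := by
  have ht : 0 < Real.sqrt σ := Real.sqrt_pos.2 hσ
  have hsq : Real.sqrt σ ^ 2 = σ := Real.sq_sqrt hσ.le
  rw [show (4 : ℝ) * σ = 4 * Real.sqrt σ ^ 2 by rw [hsq]]
  field_simp
  ring

/-! ### The potential `T(x) = ⟪e, x⟫ Φ(‖x‖)` -/

/-- `T` in the variable `σ = ‖x‖²` (`√(‖x‖²) = ‖x‖`). -/
theorem potential_eq (e : E3) :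
    (fun x : E3 => ⟪e, x⟫ * (2 - Real.exp (-‖x‖⁻¹) * (‖x‖⁻¹ ^ 2 + 2 * ‖x‖⁻¹ + 2)))
      = fun x : E3 => ⟪e, x⟫ *
          (2 - Real.exp (-(Real.sqrt (‖x‖ ^ 2))⁻¹)
            * ((Real.sqrt (‖x‖ ^ 2))⁻¹ ^ 2 + 2 * (Real.sqrt (‖x‖ ^ 2))⁻¹ + 2)) := by
  funext x; rw [Real.sqrt_sq (norm_nonneg x)]

/-- `T` is smooth off the origin. -/
theorem contDiffAt_potential (e : E3) {x : E3} (hx : x ≠ 0) {n : WithTop ℕ∞} :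
    ContDiffAt ℝ n (fun z : E3 => ⟪e, z⟫ * (2 - Real.exp (-‖z‖⁻¹) * (‖z‖⁻¹ ^ 2 + 2 * ‖z‖⁻¹ + 2))) x := by
  have h1 : ContDiffAt ℝ n (fun z : E3 => ‖z‖) x := contDiffAt_norm ℝ hx
  have h2 := (contDiffAt_profile (norm_ne_zero_iff.2 hx) (n := n)).comp x h1
  exact (innerSL ℝ e : E3 →L[ℝ] ℝ).contDiff.contDiffAt.mul h2

/-- `∇T(x) = Φ(‖x‖) e + (2⟪e,x⟫P′(‖x‖²)) x` off the origin. -/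
theorem gradient_potential_explicit (e : E3) {x : E3} (hx : x ≠ 0) :
    gradient (fun z : E3 => ⟪e, z⟫ * (2 - Real.exp (-‖z‖⁻¹) * (‖z‖⁻¹ ^ 2 + 2 * ‖z‖⁻¹ + 2))) x
      = (2 - Real.exp (-‖x‖⁻¹) * (‖x‖⁻¹ ^ 2 + 2 * ‖x‖⁻¹ + 2)) • e
        + (2 * ⟪e, x⟫ * (-(Real.exp (-‖x‖⁻¹) / (2 * ‖x‖ ^ 5)))) • x := by
  have hσ : 0 < ‖x‖ ^ 2 := by positivity
  rw [potential_eq e, gradient_potential (hasDerivAt_P hσ), Real.sqrt_sq (norm_nonneg x)]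

/-- The toroidal field of the witness: `∇T(x) × x = Φ(‖x‖) · (e × x)` off the origin. -/
theorem field_eq (e : E3) {x : E3} (hx : x ≠ 0) :
    cross (gradient (fun z : E3 => ⟪e, z⟫ * (2 - Real.exp (-‖z‖⁻¹) * (‖z‖⁻¹ ^ 2 + 2 * ‖z‖⁻¹ + 2))) x) x
      = (2 - Real.exp (-‖x‖⁻¹) * (‖x‖⁻¹ ^ 2 + 2 * ‖x‖⁻¹ + 2)) • cross e x := by
  have cross_add_left : ∀ v w z : E3, cross (v + w) z = cross v z + cross w z := fun v w z => by
    rw [← crossCLM_apply, ← crossCLM_apply, ← crossCLM_apply, map_add]; rfl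
  have cross_smul_left : ∀ (a : ℝ) (v w : E3), cross (a • v) w = a • cross v w := fun a v w => by
    rw [← crossCLM_apply, ← crossCLM_apply, map_smul]; rfl
  rw [gradient_potential_explicit e hx, cross_add_left, cross_smul_left, cross_smul_left, cross_self, smul_zero, add_zero]

/-- `|T(x)| ≤ 2‖e‖` on all of `ℝ³`. -/
theorem abs_potential_le (e x : E3) :
    |⟪e, x⟫ * (2 - Real.exp (-‖x‖⁻¹) * (‖x‖⁻¹ ^ 2 + 2 * ‖x‖⁻¹ + 2))| ≤ 2 * ‖e‖ := by
  by_cases hx : x = 0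
  · subst hx; simp
  have hr : 0 < ‖x‖ := norm_pos_iff.2 hx
  rw [abs_mul, abs_of_nonneg (profile_nonneg hr)]
  calc |⟪e, x⟫| * (2 - Real.exp (-‖x‖⁻¹) * (‖x‖⁻¹ ^ 2 + 2 * ‖x‖⁻¹ + 2))
      ≤ (‖e‖ * ‖x‖) * (2 - Real.exp (-‖x‖⁻¹) * (‖x‖⁻¹ ^ 2 + 2 * ‖x‖⁻¹ + 2)) :=
        mul_le_mul_of_nonneg_right (abs_real_inner_le_norm e x) (profile_nonneg hr)
    _ = ‖e‖ * (‖x‖ * (2 - Real.exp (-‖x‖⁻¹) * (‖x‖⁻¹ ^ 2 + 2 * ‖x‖⁻¹ + 2))) := by ring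
    _ ≤ ‖e‖ * 2 := mul_le_mul_of_nonneg_left (mul_profile_le hr) (norm_nonneg e)
    _ = 2 * ‖e‖ := by ring

/-- `‖∇T(x) × x‖ ≤ 2‖e‖` on all of `ℝ³`. -/
theorem norm_field_le (e x : E3) :
    ‖cross (gradient (fun z : E3 => ⟪e, z⟫ * (2 - Real.exp (-‖z‖⁻¹) * (‖z‖⁻¹ ^ 2 + 2 * ‖z‖⁻¹ + 2))) x) x‖
      ≤ 2 * ‖e‖ := by
  by_cases hx : x = 0
  · rw [hx, ← crossCLM_apply, map_zero, norm_zero]; positivity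
  have hr : 0 < ‖x‖ := norm_pos_iff.2 hx
  rw [field_eq e hx, norm_smul, Real.norm_eq_abs, abs_of_nonneg (profile_nonneg hr)]
  calc (2 - Real.exp (-‖x‖⁻¹) * (‖x‖⁻¹ ^ 2 + 2 * ‖x‖⁻¹ + 2)) * ‖cross e x‖
      ≤ (2 - Real.exp (-‖x‖⁻¹) * (‖x‖⁻¹ ^ 2 + 2 * ‖x‖⁻¹ + 2)) * (‖e‖ * ‖x‖) :=
        mul_le_mul_of_nonneg_left (norm_cross_le e x) (profile_nonneg hr)
    _ = ‖e‖ * (‖x‖ * (2 - Real.exp (-‖x‖⁻¹) * (‖x‖⁻¹ ^ 2 + 2 * ‖x‖⁻¹ + 2))) := by ring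
    _ ≤ ‖e‖ * 2 := mul_le_mul_of_nonneg_left (mul_profile_le hr) (norm_nonneg e)
    _ = 2 * ‖e‖ := by ring

/-- **The steady kinematic law for the point-source dipole**, at every `x ≠ 0`. -/
theorem steadyKinematicLaw (e : E3) {x : E3} (hx : x ≠ 0) :
    cross (gradient (fun z : E3 =>
        ⟪(‖z‖ ^ 3)⁻¹ • z, gradient (fun w : E3 => ⟪e, w⟫ * (2 - Real.exp (-‖w‖⁻¹) * (‖w‖⁻¹ ^ 2 + 2 * ‖w‖⁻¹ + 2))) z⟫
          - (Δ fun w : E3 => (⟪e, w⟫ * (2 - Real.exp (-‖w‖⁻¹) * (‖w‖⁻¹ ^ 2 + 2 * ‖w‖⁻¹ + 2)) : ℝ)) z) x) x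
      = cross (gradient (fun z : E3 => ⟪(‖z‖ ^ 3)⁻¹ • z, z⟫) x)
          (gradient (fun w : E3 => ⟪e, w⟫ * (2 - Real.exp (-‖w‖⁻¹) * (‖w‖⁻¹ ^ 2 + 2 * ‖w‖⁻¹ + 2))) x) := by
  rw [potential_eq e]
  exact steadyKinematicLaw_of_radialODE
    (P := fun s : ℝ => 2 - Real.exp (-(Real.sqrt s)⁻¹) * ((Real.sqrt s)⁻¹ ^ 2 + 2 * (Real.sqrt s)⁻¹ + 2))
    (P₁ := fun s : ℝ => -(Real.exp (-(Real.sqrt s)⁻¹) / (2 * Real.sqrt s ^ 5)))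
    (P₂ := fun s : ℝ => Real.exp (-(Real.sqrt s)⁻¹) * (5 * Real.sqrt s - 1) / (4 * Real.sqrt s ^ 8))
    (fun σ hσ => hasDerivAt_P hσ) (fun σ hσ => hasDerivAt_P₁ hσ)
    (fun σ hσ => contDiffAt_P hσ) (fun σ hσ => radialODE hσ) hx

/-- The dipole is not identically zero: at `x = e₀` with axis `e = e₂`, `∇T × x = Φ(1)·(e₂ × e₀) ≠ 0`. -/
theorem field_ne_zero :
    cross (gradient (fun z : E3 => ⟪EuclideanSpace.single 2 (1 : ℝ), z⟫
        * (2 - Real.exp (-‖z‖⁻¹) * (‖z‖⁻¹ ^ 2 + 2 * ‖z‖⁻¹ + 2))) (EuclideanSpace.single 0 (1 : ℝ)))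
      (EuclideanSpace.single 0 (1 : ℝ)) ≠ 0 := by
  have hx : (EuclideanSpace.single 0 (1 : ℝ) : E3) ≠ 0 := by
    intro h
    have := congrArg (fun v : E3 => v 0) h
    simp at this
  have hn0 : ‖(EuclideanSpace.single 0 (1 : ℝ) : E3)‖ = 1 := by rw [EuclideanSpace.norm_eq]; simp
  have hn2 : ‖(EuclideanSpace.single 2 (1 : ℝ) : E3)‖ = 1 := by rw [EuclideanSpace.norm_eq]; simp
  have hi : ⟪(EuclideanSpace.single 2 (1 : ℝ) : E3), EuclideanSpace.single 0 (1 : ℝ)⟫ = 0 := by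
    rw [EuclideanSpace.inner_single_left]; simp
  rw [field_eq _ hx, hn0, smul_ne_zero_iff]
  refine ⟨profile_one_pos.ne', ?_⟩
  intro h0
  have hL := Tao2016.norm_cross_sq (EuclideanSpace.single 2 (1 : ℝ) : E3) (EuclideanSpace.single 0 (1 : ℝ))
  rw [h0, norm_zero, hn0, hn2, hi] at hL
  norm_num at hL

end PointSource

open PointSource

/-- **POINT-SOURCE DIPOLE (the packaged witness).**  For every axis `e`, with the unit point-source drift `u(x) = x/‖x‖³` and
the dipole potential `T(x) = ⟪e, x⟫ Φ(‖x‖)`, `Φ(r) = 2 − e^{−1/r}(r⁻² + 2r⁻¹ + 2)`: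
`u` is `C¹` (indeed smooth) on `{0}ᶜ`, divergence free there with `‖u(x)‖ = ‖x‖⁻²`; `T` is `C³` (indeed smooth) on `{0}ᶜ`;
`|T| ≤ 2‖e‖` and `‖∇T × x‖ ≤ 2‖e‖` on all of `ℝ³`; and the STEADY KINEMATIC LAW (the body of the sketch's
`SteadyKinematicLawOn u T 0 {0}ᶜ`, `KinematicShadowSketch.lean` l.57) holds:
`∇(⟪u, ∇T⟫ − ΔT)(x) × (x − 0) = ∇⟪u, · − 0⟫(x) × ∇T(x)` for every `x ≠ 0`. -/
theorem pointSourceDipole (e : E3) :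
    ContDiffOn ℝ 1 (fun z : E3 => (‖z‖ ^ 3)⁻¹ • z) ({0}ᶜ : Set E3)
    ∧ (∀ x : E3, x ≠ 0 → VectorCalculus.divergence (fun z : E3 => (‖z‖ ^ 3)⁻¹ • z) x = 0)
    ∧ (∀ x : E3, x ≠ 0 → ‖(‖x‖ ^ 3)⁻¹ • x‖ = (‖x‖ ^ 2)⁻¹)
    ∧ ContDiffOn ℝ 3 (fun z : E3 => ⟪e, z⟫ * (2 - Real.exp (-‖z‖⁻¹) * (‖z‖⁻¹ ^ 2 + 2 * ‖z‖⁻¹ + 2))) ({0}ᶜ : Set E3)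
    ∧ (∀ x : E3, |⟪e, x⟫ * (2 - Real.exp (-‖x‖⁻¹) * (‖x‖⁻¹ ^ 2 + 2 * ‖x‖⁻¹ + 2))| ≤ 2 * ‖e‖)
    ∧ (∀ x : E3, ‖cross (gradient (fun z : E3 =>
        ⟪e, z⟫ * (2 - Real.exp (-‖z‖⁻¹) * (‖z‖⁻¹ ^ 2 + 2 * ‖z‖⁻¹ + 2))) x) (x - 0)‖ ≤ 2 * ‖e‖)
    ∧ (∀ x ∈ ({0}ᶜ : Set E3),
        cross (gradient (fun z : E3 =>
            ⟪(‖z‖ ^ 3)⁻¹ • z, gradient (fun w : E3 =>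
                ⟪e, w⟫ * (2 - Real.exp (-‖w‖⁻¹) * (‖w‖⁻¹ ^ 2 + 2 * ‖w‖⁻¹ + 2))) z⟫
              - Laplacian.laplacian (fun w : E3 =>
                (⟪e, w⟫ * (2 - Real.exp (-‖w‖⁻¹) * (‖w‖⁻¹ ^ 2 + 2 * ‖w‖⁻¹ + 2)) : ℝ)) z) x) (x - 0)
          = cross (gradient (fun z : E3 => ⟪(‖z‖ ^ 3)⁻¹ • z, z - 0⟫) x)
              (gradient (fun w : E3 => ⟪e, w⟫ * (2 - Real.exp (-‖w‖⁻¹) * (‖w‖⁻¹ ^ 2 + 2 * ‖w‖⁻¹ + 2))) x)) := by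
  refine ⟨contDiffOn_drift, fun x hx => divergence_drift hx, fun x hx => norm_drift hx,
    fun x hx => (contDiffAt_potential e hx).contDiffWithinAt, abs_potential_le e, ?_, ?_⟩
  · intro x; rw [sub_zero]; exact norm_field_le e x
  · intro x hx
    simp only [sub_zero]
    exact steadyKinematicLaw e hx

/-- **THE STEADY KINEMATIC SHADOW IS FALSE ON THE PUNCTURED SPACE.**  The sketch's `KinematicShadowSteady`
(`Cruxes/PoloidalLiouville/KinematicShadowSketch.lean` l.140) with its three DRIFT binders
`ContDiff ℝ 1 u → IsDivFree u → (∀ x, ‖u x‖ ≤ K)` weakened to `{x₀}ᶜ` — `u` of class `C¹` on `{x₀}ᶜ`, divergence free on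
`{x₀}ᶜ`, inverse-square bounded `‖u x‖ ≤ K/‖x − x₀‖²` — and every other binder (potential `C³` off `x₀`, `|T| ≤ C`,
`‖∇T × (x − x₀)‖ ≤ C`, the steady kinematic law on `{x₀}ᶜ`) and the conclusion VERBATIM, is false: witness = the point-source
dipole (`x₀ = 0`, `K = 1`, `C = 2`, axis `e₂`).  What a proof of the shadow must use is the drift AT the centre. -/
theorem kinematicShadowSteady_false_without_centre :
    ¬ (∀ (u : E3 → E3) (T : E3 → ℝ) (x₀ : E3) (K C : ℝ),
        ContDiffOn ℝ 1 u ({x₀}ᶜ : Set E3) →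
        (∀ x, x ≠ x₀ → VectorCalculus.divergence u x = 0) →
        (∀ x, x ≠ x₀ → ‖u x‖ ≤ K / ‖x - x₀‖ ^ 2) →
        ContDiffOn ℝ 3 T ({x₀}ᶜ : Set E3) → (∀ x, |T x| ≤ C) →
        (∀ x, ‖cross (gradient T x) (x - x₀)‖ ≤ C) →
        (∀ x ∈ ({x₀}ᶜ : Set E3),
          cross (gradient (fun z => ⟪u z, gradient T z⟫ - Laplacian.laplacian T z) x) (x - x₀) =
            cross (gradient (fun z => ⟪u z, z - x₀⟫) x) (gradient T x)) →
        ∀ x, cross (gradient T x) (x - x₀) = 0) := by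
  intro h
  set e : E3 := EuclideanSpace.single 2 (1 : ℝ) with he
  obtain ⟨hu, hdiv, hnorm, hT, hTb, hBb, hlaw⟩ := pointSourceDipole e
  have hne : ‖e‖ = 1 := by rw [he, EuclideanSpace.norm_eq]; simp
  have h0 := h (fun z : E3 => (‖z‖ ^ 3)⁻¹ • z)
    (fun z : E3 => ⟪e, z⟫ * (2 - Real.exp (-‖z‖⁻¹) * (‖z‖⁻¹ ^ 2 + 2 * ‖z‖⁻¹ + 2))) 0 1 2 hu hdiv
    (fun x hx => by rw [hnorm x hx, sub_zero, one_div])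
    hT (fun x => by simpa [hne] using hTb x) (fun x => by simpa [hne] using hBb x) hlaw
    (EuclideanSpace.single 0 (1 : ℝ))
  rw [sub_zero] at h0
  exact field_ne_zero h0

end Summit.NavierStokesRegularity.NavierStokesRegularity.Theorems.PoloidalLiouville.KinematicShadow
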